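import Summits.HodgeConjecture.CorCM.DihedralSexticPairCurveHodgeOfMarkmanNonGalois
import HarnessLib

/-!
# COR-CM — the Hodge conjecture for `E × B₀ × B₁` modulo Markman (non-Galois sextic CM field `K ⊇ k`):
# the statement over two plain field types `k`, `K`

Cell `pub-hodgecm2` (COR-CM), seat b30 gen 14 (2026-08-21); COUNT-NEUTRAL; theorems only, no definition, no named fact,
no `sorry`.  Consumer form of `CorCM/DihedralSexticPairCurveHodgeOfMarkmanNonGalois.lean`: there the fields form a family
`Kf : I → Type` (slots `curveSlots i₀ i₁`); here `k` and `K` are two TYPES with their own instances, `E ⊨ (k; Ψ)` is a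
CM elliptic curve, `A j ⊨ (K; Φ j)` (`j < 2`) are the two threefolds, and the sevenfold is `⨁ (Fin.cons E A)` — or
`⨁ ![E, B₀, B₁]`.  The proof instantiates the family at `Kf := (k, K)` (`Fin.cons k (fun _ => K)`, instances by
`Fin.cases`) and `i₀ := 0`, `i₁ := 1`; all identifications are definitional.

* `hodgeConjectureFor_biproduct_cons_of_not_isGalois_of_markman` — **`HodgeConjectureFor (⨁ (Fin.cons E A))` GIVEN
  ONLY `Markman2025_weilClasses_algebraic_abelianFourfold`**, for `[K:ℚ] = 6` CM not Galois, `[k:ℚ] = 2` CM,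
  `i : k →+* K`, `Φ j` not induced from `k` (`hprim`), `Φ 1 ∉ {Φ 0, (Φ 0)ᶜ}`;
* `hodgeConjectureFor_biproduct_vec_of_not_isGalois_of_markman` — the same for `⨁ ![E, B₀, B₁]`;
* `hodgeConjectureFor_of_avDominatedBy_cons_of_not_isGalois_of_markman` — every abelian variety dominated by
  `⨁ (Fin.cons E A)` (its isogeny factors; NOT the powers).

HONEST FRAMING: conditional on Markman's fourfold theorem only; `HC_CM` is not asserted.

## References
* [Markman2025SurveySecant] E. Markman, arXiv:2509.23403, Thm. 1.2.  [Pohlmann1968] Ann. of Math. 88, Thm 1.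
  [GaoUllmo2025] J. Inst. Math. Jussieu 25, Thm 3.1.  [MoonenZarhin1999LowDim] Duke 98 (1999), Thm. 0.1.
  [Shimura1998] §5.2, §8.4, §18.2.  [MumfordAV1970] §19.
-/

noncomputable section

open CategoryTheory CategoryTheory.Limits NumberField

namespace Summit.HodgeConjecture.CorCM.DihedralSexticPairCurve

open Literature.AlgebraicGeometry Literature.AlgebraicGeometry.Motives Literature.AlgebraicGeometry.HodgeTheory
open Literature.AlgebraicGeometry.ComplexMultiplication (IsCMTypeRealisation)

variable {k K : Type} [Field k] [NumberField k] [IsCMField k] [Field K] [NumberField K] [IsCMField K]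
  {E : AbelianVariety ℂ} {Ψ : CMType k} {ιE : 𝓞 k →+* End E} {θE : k →+* Module.End ℂ (complexBetti E.X 1)}

section Cons

variable {A : Fin 2 → AbelianVariety ℂ} {Φ : Fin 2 → CMType K} {ι : ∀ j, 𝓞 K →+* End (A j)}
  {θ : ∀ j, K →+* Module.End ℂ (complexBetti (A j).X 1)}

/-- **The Hodge conjecture for `E × B₀ × B₁ = ⨁ (Fin.cons E A)` modulo Markman's fourfold theorem**, over two field
types: `K` a sextic CM field NOT Galois over `ℚ`, `k` an imaginary quadratic field, `i : k →+* K`; `E ⊨ (k; Ψ)` a CM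
elliptic curve (any type `Ψ`); `A j ⊨ (K; Φ j)` with `Φ j` not induced from `k` (`hprim`: simple CM threefolds) and
`Φ 1 ≠ Φ 0, (Φ 0)ᶜ` (`A 0 ≁ A 1`) — every rational `(p,p)`-class on the abelian sevenfold `⨁ (Fin.cons E A)` is
algebraic, GIVEN ONLY `Markman2025_weilClasses_algebraic_abelianFourfold`.  (The family theorem
`hodgeConjectureFor_biproduct_curveSlots_of_not_isGalois_of_markman` at `Kf = (k, K)`.)
[cite: Markman2025SurveySecant, Thm. 1.2 and §11.5 Step 2] [cite: Pohlmann1968, Thm 1] [cite: GaoUllmo2025, Thm 3.1]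
[cite: MoonenZarhin1999LowDim, Thm. 0.1] [cite: Shimura1998, §8.4] -/
theorem hodgeConjectureFor_biproduct_cons_of_not_isGalois_of_markman
    (hW4 : Markman2025_weilClasses_algebraic_abelianFourfold)
    (h6 : Module.finrank ℚ K = 6) (h2 : Module.finrank ℚ k = 2) (i : k →+* K) (hK : ¬ IsGalois ℚ K)
    (hE : IsCMTypeRealisation Ψ E ιE θE) (hA : ∀ j, IsCMTypeRealisation (Φ j) (A j) (ι j) (θ j))
    (hprim : ∀ j, ∃ s ∈ (Φ j).1, ∃ s' ∈ (Φ j).1, s.comp i ≠ s'.comp i)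
    (hne : (Φ 0).1 ≠ (Φ 1).1) (hne' : (Φ 1).1 ≠ (Φ 0).1ᶜ) :
    HodgeConjectureFor (⨁ (Fin.cons E A : Fin 3 → AbelianVariety ℂ)).dim
      (⨁ (Fin.cons E A : Fin 3 → AbelianVariety ℂ)).X := by
  -- the family of fields `(k, K)` with its instances (all identifications below are definitional)
  let Kf : Fin 2 → Type := Fin.cons k fun _ : Fin 1 => K
  letI instF : ∀ j, Field (Kf j) := fun j =>
    Fin.cases (motive := fun j => Field (Kf j)) ‹Field k› (fun _ => ‹Field K›) j
  letI instN : ∀ j, NumberField (Kf j) := fun j =>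
    Fin.cases (motive := fun j => NumberField (Kf j)) ‹NumberField k› (fun _ => ‹NumberField K›) j
  haveI instC : ∀ j, IsCMField (Kf j) := fun j =>
    Fin.cases (motive := fun j => IsCMField (Kf j)) ‹IsCMField k› (fun _ => ‹IsCMField K›) j
  exact hodgeConjectureFor_biproduct_curveSlots_of_not_isGalois_of_markman (Kf := Kf) (i₀ := 0) (i₁ := 1)
    (A₃ := Fin.cons E A) (Φ₃ := Fin.cons Ψ Φ) (ι₃ := Fin.cons ιE ι) (θ₃ := Fin.cons θE θ)
    hW4 h6 h2 i hK (Fin.cases hE hA) hprim hne hne'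

/-- **The Hodge conjecture for every abelian variety dominated by `⨁ (Fin.cons E A)`** (its isogeny factors — `E`,
`A j`, `E × A j`, `A 0 × A 1`, `E × A 0 × A 1` in any bracketing; NOT the powers), over two field types, modulo
Markman. [cite: Markman2025SurveySecant, Thm. 1.2] [cite: MumfordAV1970, §19] -/
theorem hodgeConjectureFor_of_avDominatedBy_cons_of_not_isGalois_of_markman
    (hW4 : Markman2025_weilClasses_algebraic_abelianFourfold)
    (h6 : Module.finrank ℚ K = 6) (h2 : Module.finrank ℚ k = 2) (i : k →+* K) (hK : ¬ IsGalois ℚ K)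
    (hE : IsCMTypeRealisation Ψ E ιE θE) (hA : ∀ j, IsCMTypeRealisation (Φ j) (A j) (ι j) (θ j))
    (hprim : ∀ j, ∃ s ∈ (Φ j).1, ∃ s' ∈ (Φ j).1, s.comp i ≠ s'.comp i)
    (hne : (Φ 0).1 ≠ (Φ 1).1) (hne' : (Φ 1).1 ≠ (Φ 0).1ᶜ)
    {B : AbelianVariety ℂ} (hB : Domination.AVDominatedBy B (⨁ (Fin.cons E A : Fin 3 → AbelianVariety ℂ))) :
    HodgeConjectureFor B.dim B.X :=
  Domination.hodgeConjectureFor_of_avDominatedBy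
    (hodgeConjectureFor_biproduct_cons_of_not_isGalois_of_markman hW4 h6 h2 i hK hE hA hprim hne hne') hB

end Cons

section Vec

variable {B₀ B₁ : AbelianVariety ℂ} {Φ₀ Φ₁ : CMType K} {ι₀ : 𝓞 K →+* End B₀} {ι₁ : 𝓞 K →+* End B₁}
  {θ₀ : K →+* Module.End ℂ (complexBetti B₀.X 1)} {θ₁ : K →+* Module.End ℂ (complexBetti B₁.X 1)}

/-- **The Hodge conjecture for `⨁ ![E, B₀, B₁]` modulo Markman's fourfold theorem** — the three realisations given one
by one: `E ⊨ (k; Ψ)`, `B₀ ⊨ (K; Φ₀)`, `B₁ ⊨ (K; Φ₁)`, `K ⊇ i(k)` sextic CM not Galois, `Φ_m` not induced from `k`,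
`Φ₁ ≠ Φ₀, Φ₀ᶜ`. [cite: Markman2025SurveySecant, Thm. 1.2] [cite: Pohlmann1968, Thm 1] [cite: Shimura1998, §8.4] -/
theorem hodgeConjectureFor_biproduct_vec_of_not_isGalois_of_markman
    (hW4 : Markman2025_weilClasses_algebraic_abelianFourfold)
    (h6 : Module.finrank ℚ K = 6) (h2 : Module.finrank ℚ k = 2) (i : k →+* K) (hK : ¬ IsGalois ℚ K)
    (hE : IsCMTypeRealisation Ψ E ιE θE) (hB₀ : IsCMTypeRealisation Φ₀ B₀ ι₀ θ₀)
    (hB₁ : IsCMTypeRealisation Φ₁ B₁ ι₁ θ₁)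
    (hprim₀ : ∃ s ∈ Φ₀.1, ∃ s' ∈ Φ₀.1, s.comp i ≠ s'.comp i)
    (hprim₁ : ∃ s ∈ Φ₁.1, ∃ s' ∈ Φ₁.1, s.comp i ≠ s'.comp i)
    (hne : Φ₀.1 ≠ Φ₁.1) (hne' : Φ₁.1 ≠ Φ₀.1ᶜ) :
    HodgeConjectureFor (⨁ (![E, B₀, B₁] : Fin 3 → AbelianVariety ℂ)).dim
      (⨁ (![E, B₀, B₁] : Fin 3 → AbelianVariety ℂ)).X := by
  -- the two threefolds as families over `Fin 2` (`![E, B₀, B₁] = Fin.cons E ![B₀, B₁]` definitionally)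
  let A : Fin 2 → AbelianVariety ℂ := ![B₀, B₁]
  let Φ : Fin 2 → CMType K := ![Φ₀, Φ₁]
  let ι : ∀ j, 𝓞 K →+* End (A j) := Fin.cons ι₀ (Fin.cons ι₁ finZeroElim)
  let θ : ∀ j, K →+* Module.End ℂ (complexBetti (A j).X 1) := Fin.cons θ₀ (Fin.cons θ₁ finZeroElim)
  have hA : ∀ j, IsCMTypeRealisation (Φ j) (A j) (ι j) (θ j) := Fin.forall_fin_two.2 ⟨hB₀, hB₁⟩
  have hprim : ∀ j, ∃ s ∈ (Φ j).1, ∃ s' ∈ (Φ j).1, s.comp i ≠ s'.comp i :=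
    Fin.forall_fin_two.2 ⟨hprim₀, hprim₁⟩
  exact hodgeConjectureFor_biproduct_cons_of_not_isGalois_of_markman (E := E) (A := A) hW4 h6 h2 i hK hE hA hprim
    hne hne'

end Vec

end Summit.HodgeConjecture.CorCM.DihedralSexticPairCurve

end
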